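import Summits.HodgeConjecture.CorCM.MumfordTateRankThreefoldsSharp
import Summits.HodgeConjecture.CorCM.MumfordTateRankTimesNonCMCurve
import Summits.HodgeConjecture.CorCM.MumfordTateRankDuplicateFactor
import Summits.HodgeConjecture.CorCM.MumfordTateRankSemisimpleTimesCM
import Summits.HodgeConjecture.CorCM.IrreducibleOddWeightsHodgeGluing
import Summits.HodgeConjecture.CorCM.RankFourCMProductCMType
import Literature.AlgebraicGeometry.Motives.AbelianVarietyProductIsogeny
import HarnessLib

/-!
# Arbitrary products of elliptic curves: `dim MT(H¹(E₀ × ⋯ × E_m)) = 3a + b + 1`, `a` and `b` the numbers of isogeny classes of the curves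
# WITHOUT and WITH complex multiplication (Imai; Moonen–Zarhin 1999 §3 (3.4), (3.8); Kubota) — any multiplicities, any isogenies

COR-CM (cell `pub-hodgecm2`, seat `b27` gen 49, count-neutral Mumford–Tate-rank ladder; theorems only, no definition, no named fact;
UNCONDITIONAL — nothing here uses or asserts HC_CM).  Notation `t(X) = dim MT(H¹X)`.

The tree has the formula for PAIRWISE NON-ISOGENOUS families (`CorCM/MumfordTateRankTimesNonCMCurve`: `t((⨁ C) × (⨁ E)) = 3(a+1) + (b+1) + 1`,
Imai's `SL₂^{a+1}` times a torus of rank `b+1`).  This file removes that hypothesis: for ANY finite family of elliptic curves `E : Fin (m+1) → AV`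
and `X ∼ ⨁_j E_j`, **`t(X) = 3a + b + 1` where `a` (`b`) is the number of isogeny classes of non-CM (CM) curves among the `E_j`** — stated as
`∃ a b, 1 ≤ a + b ≤ m + 1 ∧ t(X) = 3a + b + 1 ∧ (a = 0 ↔ all CM) ∧ (b = 0 ↔ none CM)`.  Steps:
* §1 non-CM curves with repetitions (`exists_mtRank_hodge_one_eq_of_biproduct_nonCM_curves`): peel `E₀` off — a curve isogenous to a later one
  does not change `t` (`CorCM/MumfordTateRankDuplicateFactor`), a new one adds `3` (`Hom(⨁_{j≥1} E_j, E₀) = 0`, Moonen–Zarhin (3.4));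
* §2 CM curves with repetitions (`exists_mtRank_hodge_one_eq_of_biproduct_cm_curves`): regroup into isogeny classes (a quotient of the index
  set, `biproduct.map` of isogenies onto the representatives) and count `#classes + 1` (`CorCM/MumfordTateRankThree`, Kubota);
* §3 the general case (`exists_mtRank_hodge_one_eq_of_biproduct_curves`): split the index set by «CM», reindex both parts by `Fin`, and add
  with `t(X) + 1 = t(X_N) + t(X_C)` (`X_N` without factor of type IV, `X_C` of CM type: Moonen–Zarhin Thm. (3.2)(2));
* §4 the tables: three curves `t ∈ {2, …, 8, 10}`, FOUR curves (fourfold partition `{1,1,1,1}`) `t ∈ {2, …, 11, 13}`, five curves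
  `t ∈ {2, …, 14, 16}`, and `2 ≤ t ≤ 3(m+1) + 1` always.

## References
* [MoonenZarhin1999LowDim] B. Moonen, Yu. G. Zarhin, *Hodge classes on abelian varieties of low dimension*, Math. Ann. 315 (1999), §3 Thm. (3.2)(2),
  Lemma (3.4), Prop. (3.8) [corpus: paper:arxiv-math_9901113 pp. 6–7]. [cite: MoonenZarhin1999LowDim, §3 (3.4) and (3.8)]
* [Gordon1999HodgeAVSurvey] B. B. Gordon, *A survey of the Hodge conjecture for abelian varieties*, §3 Theorem (Imai, Murty), 7.5, 7.6.1.
  [cite: Gordon1999HodgeAVSurvey, §3 Theorem (Imai) and 7.6.1]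
* [MumfordAV1970] D. Mumford, *Abelian Varieties* (1970), §19 Thm. 1 and Cor. 2. [cite: MumfordAV1970, §19 Thm. 1]
-/

noncomputable section

open CategoryTheory CategoryTheory.Limits Module
open scoped BigOperators

namespace Summit.HodgeConjecture.CorCM

open Literature.AlgebraicGeometry.Motives
open Literature.AlgebraicGeometry.Motives.AbelianVariety
open Literature.AlgebraicGeometry.Motives.HodgeStructure
open Literature.AlgebraicGeometry.HodgeTheory
open Literature.AlgebraicGeometry.Milne1999 (IsOfCMType isOfCMType_iff_of_isIsogenous hom_eq_zero_of_isSimple_of_not_isIsogenous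
  isIsogeny_biproduct_map)

variable [HodgeTensorFacts.{0, 0}] {X : AbelianVariety ℂ} {n : ℕ}

/-! ## §0 Plumbing: one-term biproducts, splitting off an index -/

omit [HodgeTensorFacts.{0, 0}] in
/-- A biproduct over a one-element index type is isogenous (isomorphic) to its term. [cite: MumfordAV1970, §19 Thm. 1] -/
theorem isIsogenous_biproduct_of_forall_eq {J : Type} [Fintype J] [DecidableEq J] (f : J → AbelianVariety ℂ) (j₀ : J) (hJ : ∀ j, j = j₀) :
    IsIsogenous (⨁ f) (f j₀) := by
  refine ⟨biproduct.π f j₀, isIsogeny_hom_of_iso ⟨biproduct.π f j₀, biproduct.ι f j₀, ?_, biproduct.ι_π_self _ _⟩⟩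
  refine biproduct.hom_ext _ _ fun j => ?_
  obtain rfl : j = j₀ := hJ j
  rw [Category.assoc, biproduct.ι_π_self, Category.comp_id, Category.id_comp]

omit [HodgeTensorFacts.{0, 0}] in
/-- **Splitting off one index**: `⨁_j f_j ∼ (⨁_{j ≠ j₀} f_j) × f_{j₀}`. [cite: MumfordAV1970, §19 Thm. 1] -/
theorem isIsogenous_biproduct_prod_erase {J : Type} [Fintype J] [DecidableEq J] (f : J → AbelianVariety ℂ) (j₀ : J) :
    IsIsogenous (⨁ f) ((⨁ fun j : {j // j ≠ j₀} => f j.1).prod (f j₀)) := by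
  obtain ⟨g, hg⟩ := isIsogenous_biproduct_of_forall_eq (fun j : {j // ¬ j ≠ j₀} => f j.1) ⟨j₀, fun h => h rfl⟩
    fun j => Subtype.ext (not_not.1 j.2)
  exact (isIsogenous_biproduct_prod_subtype f (· ≠ j₀)).trans ⟨prodMap (𝟙 _) g, isIsogeny_prodMap (isIsogeny_id _) hg⟩

/-! ## §1 Non-CM curves with repetitions: `t = 3a + 1` -/

/-- **Non-CM elliptic curves, any isogenies among them: `t(⨁_j E_j) = 3a + 1` with `1 ≤ a ≤ m + 1`** (`a` = number of isogeny classes;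
`Hg = SL₂^a`).  Peel off `E₀`: if `E₀ ∼ E_j` for some `j ≥ 1` the rank is that of the tail (a duplicate factor), else it grows by `3`.
[cite: MoonenZarhin1999LowDim, §3 (3.4) and (3.8)] [cite: Gordon1999HodgeAVSurvey, §3 Theorem (Imai) and 7.6.1] -/
theorem exists_mtRank_hodge_one_eq_of_biproduct_nonCM_curves : ∀ {m : ℕ} {X : AbelianVariety ℂ} {n : ℕ} (hX : IsSmoothProjective n X.X)
    {E : Fin (m + 1) → AbelianVariety ℂ}, (∀ j, (E j).dim = 1) → (∀ j, ¬ IsOfCMType (E j)) → IsIsogenous X (⨁ E) →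
    haveI := BettiUniverse.finite hX 1
    ∃ a : ℕ, 1 ≤ a ∧ a ≤ m + 1 ∧ (BettiUniverse.hodge exists_isReal_hodgeModel_holds hX 1).mtRank = 3 * a + 1
  | 0, X, n, hX, E, hE1, hcm, hXE =>
    ⟨1, le_rfl, le_rfl, mtRank_hodge_one_eq_of_biproduct_nonCM_curves hX hE1 hcm (fun j l hjl => absurd (Fin.ext (by have := j.2; have := l.2; omega)) hjl) hXE⟩
  | m + 1, X, n, hX, E, hE1, hcm, hXE => by
    classical
    haveI := BettiUniverse.finite hX 1
    -- `⨁ E ∼ E 0 × ⨁ (E ∘ succ)`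
    obtain ⟨h, g, hhg, hgh⟩ := AndreRiemann.biproduct_succ_split E
    have hh : IsIsogeny h := isIsogeny_of_comp_eq_of_comp_eq (isIsogeny_id _) (isIsogeny_id _) hgh hhg
    have hXP : IsIsogenous X ((E 0).prod (⨁ (E ∘ Fin.succ))) := hXE.trans ⟨h, hh⟩
    have hA : IsSmoothProjective (⨁ (E ∘ Fin.succ)).dim (⨁ (E ∘ Fin.succ)).X := AbelianVariety.isSmoothProjective_holds
    haveI := BettiUniverse.finite hA 1
    obtain ⟨a, ha1, ham, ih⟩ := exists_mtRank_hodge_one_eq_of_biproduct_nonCM_curves hA (E := E ∘ Fin.succ) (fun j => hE1 j.succ)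
      (fun j => hcm j.succ) (IsIsogenous.refl _)
    by_cases hdup : ∃ j : Fin (m + 1), IsIsogenous (E 0) (E j.succ)
    · -- a duplicate factor: `X ∼ ((⨁_{l ≠ j} E_{l+1}) × E_{j+1}) × E 0` with `E 0 ∼ E_{j+1}`
      obtain ⟨j, ⟨g₀, hg₀⟩⟩ := hdup
      obtain ⟨u, hu⟩ := isIsogenous_biproduct_prod_erase (E ∘ Fin.succ) j
      have hXQ : IsIsogenous X ((((⨁ fun l : {l // l ≠ j} => (E ∘ Fin.succ) l.1).prod ((E ∘ Fin.succ) j))).prod ((E ∘ Fin.succ) j)) :=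
        (hXP.trans (Literature.AlgebraicGeometry.HodgeTheory.isIsogenous_prod_comm _ _)).trans ⟨prodMap u g₀, isIsogeny_prodMap hu hg₀⟩
      have h0 : 0 < ((⨁ fun l : {l // l ≠ j} => (E ∘ Fin.succ) l.1).prod ((E ∘ Fin.succ) j)).dim := by
        have h1 := hE1 j.succ
        rw [dim_prod]
        simp only [Function.comp_apply]
        omega
      have hdq := mtRank_hodge_one_eq_of_isIsogenous_prod_prod_self hX hA h0 hXQ ⟨u, hu⟩
      exact ⟨a, ha1, by omega, hdq.trans ih⟩
    · -- a new curve: `Hom(⨁ (E ∘ succ), E 0) = 0`, `t(X) = t(tail) + 3`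
      push Not at hdup
      have hA0 : 0 < (⨁ (E ∘ Fin.succ)).dim := by
        rw [AndreRiemann.dim_biproduct_fin]
        exact Finset.sum_pos (fun j _ => by rw [Function.comp_apply, hE1]; exact one_pos) Finset.univ_nonempty
      have hAE : ∀ v : (⨁ (E ∘ Fin.succ)) ⟶ E 0, v = 0 := fun v => by
        refine biproduct.hom_ext' _ _ fun j => ?_
        rw [comp_zero]
        exact hom_eq_zero_of_isSimple_of_not_isIsogenous (isSimple_of_dim_le_one (hE1 j.succ).le) (isSimple_of_dim_le_one (hE1 0).le)
          (fun hiso => hdup j hiso.symm') _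
      have h3 := mtRank_hodge_one_eq_add_three_of_isIsogenous_nonCMCurve_prod hX hA hA0 (hE1 0) (hcm 0) hAE hXP
      exact ⟨a + 1, by omega, by omega, by rw [h3, ih]; ring⟩

/-! ## §2 CM curves with repetitions: `t = b + 1` -/

/-- **CM elliptic curves, any isogenies among them: `t(⨁_j E_j) = b + 1` with `1 ≤ b ≤ m + 1`** (`b` = number of isogeny classes; `Hg` a torus
of rank `b`): regroup the family into its isogeny classes and count (`mtRank_hodge_one_eq_card_add_one_of_isIsogenous_biproduct_elliptic`).
[cite: MoonenZarhin1999LowDim, §3 (3.4)] [cite: Gordon1999HodgeAVSurvey, 7.5 and 7.6.1] -/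
theorem exists_mtRank_hodge_one_eq_of_biproduct_cm_curves {m : ℕ} (hX : IsSmoothProjective n X.X) {E : Fin (m + 1) → AbelianVariety ℂ}
    (hE1 : ∀ j, (E j).dim = 1) (hcm : ∀ j, IsOfCMType (E j)) (hXE : IsIsogenous X (⨁ E)) :
    haveI := BettiUniverse.finite hX 1
    ∃ b : ℕ, 1 ≤ b ∧ b ≤ m + 1 ∧ (BettiUniverse.hodge exists_isReal_hodgeModel_holds hX 1).mtRank = b + 1 := by
  classical
  -- the isogeny classes of the curves and representatives
  let r : Setoid (Fin (m + 1)) :=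
    ⟨fun i j => IsIsogenous (E i) (E j), ⟨fun _ => IsIsogenous.refl _, fun h => h.symm', fun h h' => h.trans h'⟩⟩
  let cls : Fin (m + 1) → Quotient r := Quotient.mk r
  let R : Quotient r → AbelianVariety ℂ := fun c => E c.out
  have hcls : Function.Surjective cls := fun c => ⟨c.out, c.out_eq⟩
  have hrel : ∀ j, IsIsogenous (E j) (R (cls j)) := fun j => by
    have h : r.r (cls j).out j := Quotient.exact (cls j).out_eq
    exact IsIsogenous.symm' h
  have hniso : ∀ c c', c ≠ c' → ¬ IsIsogenous (R c) (R c') := fun c c' hne h =>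
    hne (by rw [← c.out_eq, ← c'.out_eq]; exact Quotient.sound h)
  choose g hg using hrel
  have hXB : IsIsogenous X (⨁ fun j => R (cls j)) := hXE.trans ⟨biproduct.map g, isIsogeny_biproduct_map hg⟩
  have h := mtRank_hodge_one_eq_card_add_one_of_isIsogenous_biproduct_elliptic (E := R) (fun c => hE1 _) (fun c => hcm _) hniso hcls hX hXB
  refine ⟨Fintype.card (Quotient r), Fintype.card_pos_iff.2 ⟨cls 0⟩, ?_, h⟩
  simpa using Fintype.card_le_of_surjective cls hcls

/-! ## §3 Arbitrary elliptic curves: `t = 3a + b + 1` -/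

/-- **`t(E₀ × ⋯ × E_m) = 3a + b + 1` for ARBITRARY elliptic curves** — `a` the number of isogeny classes of the curves without complex
multiplication, `b` of those with (`Hg = SL₂^a × T^b`); `1 ≤ a + b ≤ m + 1`, `a = 0` iff all curves are CM, `b = 0` iff none is.  Split the index
set by «CM», reindex both parts by `Fin`, `t(X) + 1 = t(X_N) + t(X_C)` (`X_N` has no factor of type IV, `X_C` is of CM type), §1 and §2.
[cite: MoonenZarhin1999LowDim, §3 Thm. (3.2)(2), (3.4) and (3.8)] [cite: Gordon1999HodgeAVSurvey, §3 Theorem (Imai) and 7.6.1] -/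
theorem exists_mtRank_hodge_one_eq_of_biproduct_curves {m : ℕ} (hX : IsSmoothProjective n X.X) {E : Fin (m + 1) → AbelianVariety ℂ}
    (hE1 : ∀ j, (E j).dim = 1) (hXE : IsIsogenous X (⨁ E)) :
    haveI := BettiUniverse.finite hX 1
    ∃ a b : ℕ, 1 ≤ a + b ∧ a + b ≤ m + 1 ∧ (BettiUniverse.hodge exists_isReal_hodgeModel_holds hX 1).mtRank = 3 * a + b + 1 ∧
      (a = 0 ↔ ∀ j, IsOfCMType (E j)) ∧ (b = 0 ↔ ∀ j, ¬ IsOfCMType (E j)) := by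
  classical
  haveI := BettiUniverse.finite hX 1
  by_cases hall : ∀ j, IsOfCMType (E j)
  · obtain ⟨b, hb1, hbm, ht⟩ := exists_mtRank_hodge_one_eq_of_biproduct_cm_curves hX hE1 hall hXE
    exact ⟨0, b, by omega, by omega, by rw [ht]; ring, ⟨fun _ => hall, fun _ => rfl⟩, ⟨fun h => by omega, fun h => absurd (hall 0) (h 0)⟩⟩
  by_cases hnone : ∀ j, ¬ IsOfCMType (E j)
  · obtain ⟨a, ha1, ham, ht⟩ := exists_mtRank_hodge_one_eq_of_biproduct_nonCM_curves hX hE1 hnone hXE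
    exact ⟨a, 0, by omega, by omega, by rw [ht], ⟨fun h => by omega, fun h => absurd (h 0) (hnone 0)⟩, ⟨fun _ => hnone, fun _ => rfl⟩⟩
  push Not at hall hnone
  obtain ⟨j₁, hj₁⟩ := hall
  obtain ⟨j₂, hj₂⟩ := hnone
  -- split the index set by «CM» and reindex both parts by `Fin`
  let p : Fin (m + 1) → Prop := fun j => IsOfCMType (E j)
  have hsplit := isIsogenous_biproduct_prod_subtype E p
  have hcC : Fintype.card {j // p j} ≠ 0 := (Fintype.card_pos_iff.2 ⟨⟨j₂, hj₂⟩⟩).ne'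
  have hcN : Fintype.card {j // ¬ p j} ≠ 0 := (Fintype.card_pos_iff.2 ⟨⟨j₁, hj₁⟩⟩).ne'
  obtain ⟨mC, hmC⟩ := Nat.exists_eq_succ_of_ne_zero hcC
  obtain ⟨mN, hmN⟩ := Nat.exists_eq_succ_of_ne_zero hcN
  let eC : Fin (mC + 1) ≃ {j // p j} := (finCongr hmC).symm.trans (Fintype.equivFin {j // p j}).symm
  let eN : Fin (mN + 1) ≃ {j // ¬ p j} := (finCongr hmN).symm.trans (Fintype.equivFin {j // ¬ p j}).symm
  let EC : Fin (mC + 1) → AbelianVariety ℂ := (fun j : {j // p j} => E j.1) ∘ eC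
  let EN : Fin (mN + 1) → AbelianVariety ℂ := (fun j : {j // ¬ p j} => E j.1) ∘ eN
  have hPC : IsIsogenous (⨁ fun j : {j // p j} => E j.1) (⨁ EC) :=
    ⟨(biproduct.reindex eC (fun j : {j // p j} => E j.1)).inv, isIsogeny_hom_of_iso (biproduct.reindex eC _).symm⟩
  have hPN : IsIsogenous (⨁ fun j : {j // ¬ p j} => E j.1) (⨁ EN) :=
    ⟨(biproduct.reindex eN (fun j : {j // ¬ p j} => E j.1)).inv, isIsogeny_hom_of_iso (biproduct.reindex eN _).symm⟩
  obtain ⟨uC, huC⟩ := hPC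
  obtain ⟨uN, huN⟩ := hPN
  have hXQ : IsIsogenous X ((⨁ EN).prod (⨁ EC)) :=
    ((hXE.trans hsplit).trans ⟨prodMap uC uN, isIsogeny_prodMap huC huN⟩).trans
      (Literature.AlgebraicGeometry.HodgeTheory.isIsogenous_prod_comm _ _)
  -- the two parts
  have hN : IsSmoothProjective (⨁ EN).dim (⨁ EN).X := AbelianVariety.isSmoothProjective_holds
  have hC : IsSmoothProjective (⨁ EC).dim (⨁ EC).X := AbelianVariety.isSmoothProjective_holds
  haveI := BettiUniverse.finite hN 1
  haveI := BettiUniverse.finite hC 1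
  have hEN1 : ∀ i, (EN i).dim = 1 := fun i => hE1 _
  have hEC1 : ∀ i, (EC i).dim = 1 := fun i => hE1 _
  have hENcm : ∀ i, ¬ IsOfCMType (EN i) := fun i => (eN i).2
  have hECcm : ∀ i, IsOfCMType (EC i) := fun i => (eC i).2
  have hN0 : 0 < (⨁ EN).dim := by
    rw [AndreRiemann.dim_biproduct_fin]
    exact Finset.sum_pos (fun j _ => by rw [hEN1]; exact one_pos) Finset.univ_nonempty
  have hC0 : 0 < (⨁ EC).dim := by
    rw [AndreRiemann.dim_biproduct_fin]
    exact Finset.sum_pos (fun j _ => by rw [hEC1]; exact one_pos) Finset.univ_nonempty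
  have hN4 : HasNoTypeIVFactor (⨁ EN) := hasNoTypeIVFactor_biproduct_fin EN fun i => (curve_facts_of_not_isOfCMType (hEN1 i) (hENcm i)).2.2.1
  have hCcm : IsOfCMType (⨁ EC) := RankFourWeil.isOfCMType_biproduct_fin EC hECcm
  have hsum := mtRank_hodge_one_add_one_eq_add_of_isIsogenous_prod hX hN hC hN0 hC0 hN4 hCcm hXQ
  obtain ⟨a, ha1, ham, htN⟩ := exists_mtRank_hodge_one_eq_of_biproduct_nonCM_curves hN hEN1 hENcm (IsIsogenous.refl _)
  obtain ⟨b, hb1, hbm, htC⟩ := exists_mtRank_hodge_one_eq_of_biproduct_cm_curves hC hEC1 hECcm (IsIsogenous.refl _)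
  rw [htN, htC] at hsum
  have hcard : Fintype.card {j // ¬ p j} = Fintype.card (Fin (m + 1)) - Fintype.card {j // p j} := Fintype.card_subtype_compl p
  have hle : Fintype.card {j // p j} ≤ Fintype.card (Fin (m + 1)) := Fintype.card_subtype_le p
  rw [Fintype.card_fin] at hcard hle
  refine ⟨a, b, by omega, by omega, by omega, ⟨fun h => by omega, fun h => absurd (h j₁) hj₁⟩, ⟨fun h => by omega, fun h => absurd hj₂ (h j₂)⟩⟩

/-! ## §4 Tables: three, four, five curves; the general bounds -/

/-- **`2 ≤ t(E₀ × ⋯ × E_m) ≤ 3(m+1) + 1`** for arbitrary elliptic curves. [cite: MoonenZarhin1999LowDim, §3 (3.4) and (3.8)] -/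
theorem two_le_mtRank_hodge_one_and_le_of_biproduct_curves {m : ℕ} (hX : IsSmoothProjective n X.X) {E : Fin (m + 1) → AbelianVariety ℂ}
    (hE1 : ∀ j, (E j).dim = 1) (hXE : IsIsogenous X (⨁ E)) :
    haveI := BettiUniverse.finite hX 1
    2 ≤ (BettiUniverse.hodge exists_isReal_hodgeModel_holds hX 1).mtRank ∧
      (BettiUniverse.hodge exists_isReal_hodgeModel_holds hX 1).mtRank ≤ 3 * (m + 1) + 1 := by
  obtain ⟨a, b, h1, hm, ht, -, -⟩ := exists_mtRank_hodge_one_eq_of_biproduct_curves hX hE1 hXE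
  constructor <;> omega

/-- **Three elliptic curves (the threefold partition `{1,1,1}`): `t ∈ {2, 3, 4, 5, 6, 7, 8, 10}`.** [cite: MoonenZarhin1999LowDim, §3 (3.4) and (3.8)] -/
theorem mtRank_hodge_one_mem_of_biproduct_three_curves (hX : IsSmoothProjective n X.X) {E : Fin 3 → AbelianVariety ℂ}
    (hE1 : ∀ j, (E j).dim = 1) (hXE : IsIsogenous X (⨁ E)) :
    haveI := BettiUniverse.finite hX 1
    (BettiUniverse.hodge exists_isReal_hodgeModel_holds hX 1).mtRank ∈ ({2, 3, 4, 5, 6, 7, 8, 10} : Finset ℕ) := by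
  obtain ⟨a, b, h1, hm, ht, -, -⟩ := exists_mtRank_hodge_one_eq_of_biproduct_curves (m := 2) hX hE1 hXE
  simp only [Finset.mem_insert, Finset.mem_singleton]
  omega

/-- **Four elliptic curves (the fourfold partition `{1,1,1,1}`): `t ∈ {2, 3, 4, 5, 6, 7, 8, 9, 10, 11, 13}`.**
[cite: MoonenZarhin1999LowDim, §3 (3.4) and (3.8)] [cite: Gordon1999HodgeAVSurvey, §3 Theorem (Imai) and 7.6.1] -/
theorem mtRank_hodge_one_mem_of_biproduct_four_curves (hX : IsSmoothProjective n X.X) {E : Fin 4 → AbelianVariety ℂ}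
    (hE1 : ∀ j, (E j).dim = 1) (hXE : IsIsogenous X (⨁ E)) :
    haveI := BettiUniverse.finite hX 1
    (BettiUniverse.hodge exists_isReal_hodgeModel_holds hX 1).mtRank ∈ ({2, 3, 4, 5, 6, 7, 8, 9, 10, 11, 13} : Finset ℕ) := by
  obtain ⟨a, b, h1, hm, ht, -, -⟩ := exists_mtRank_hodge_one_eq_of_biproduct_curves (m := 3) hX hE1 hXE
  simp only [Finset.mem_insert, Finset.mem_singleton]
  omega

/-- **Five elliptic curves: `t ∈ {2, …, 14, 16}`.** [cite: MoonenZarhin1999LowDim, §3 (3.4) and (3.8)] -/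
theorem mtRank_hodge_one_mem_of_biproduct_five_curves (hX : IsSmoothProjective n X.X) {E : Fin 5 → AbelianVariety ℂ}
    (hE1 : ∀ j, (E j).dim = 1) (hXE : IsIsogenous X (⨁ E)) :
    haveI := BettiUniverse.finite hX 1
    (BettiUniverse.hodge exists_isReal_hodgeModel_holds hX 1).mtRank ∈ ({2, 3, 4, 5, 6, 7, 8, 9, 10, 11, 12, 13, 14, 16} : Finset ℕ) := by
  obtain ⟨a, b, h1, hm, ht, -, -⟩ := exists_mtRank_hodge_one_eq_of_biproduct_curves (m := 4) hX hE1 hXE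
  simp only [Finset.mem_insert, Finset.mem_singleton]
  omega

end Summit.HodgeConjecture.CorCM

end
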